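import Mathlib.NumberTheory.LegendreSymbol.QuadraticChar.Basic
import Mathlib.Data.ZMod.Basic
import Mathlib.Algebra.BigOperators.Group.Finset.Basic
import Mathlib.Tactic.Ring
import Mathlib.Tactic.Linarith
import Mathlib.Tactic.NormNum
import HarnessLib

/-!
# Venture HSemireg — LEMMA UV's local cells and the SPLITTING LEMMA's algebra (ENGINE-W PROBE5 §21, THE LOCAL–GLOBAL STEP):
# (i) for every odd prime `p` there is a residue `s` with `s` AND `1 − s` quadratic non-residues (the ramified cell), by a
# character-sum argument that needs no evaluation of the Jacobi sum; (ii) the dyadic value sets `V₈(m)` and the `p = 2` witness cells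
# with a Hensel variable; (iii) the splitting vector `w = u₂σ(y)f₁ − u₁σ(x)f₂`: `⟨w,v⟩ = 0`, `⟨w,w⟩ = u₁u₂(u₁N(x) + u₂N(y))`,
# `det[v w] = −(u₁N(x) + u₂N(y))` — kernel arithmetic

HONEST FRAMING. Lean index of the computation cell `pub-hsemireg`, widening group ENGINE-W (code A, seat `engine-w-1`, gen 18).
FINITE-FIELD CHARACTER SUMS (Mathlib's `quadraticChar`), RESIDUE TABLES MOD 8 AND RING IDENTITIES ONLY; no lattice, genus, abelian variety,
sheaf, `Ext` group, secant structure, autoequivalence or semiregularity map is constructed; Kitaoka's Theorem 6.6.1 (the global step) is NOT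
formalised; nothing here says that HC, HC_CM or HC_AV holds. Theorems only (0 `def`, 0 named fact, 0 `sorry`). New namespace `UnitVectors`.

SOURCE (the cell's own result, by value): `widen/ENGINE-W/out/probe5/PROBE5-STIZ-A.md` §21 «LEMMA UV (unit vectors). For ANY two pieces
(I₁,u₁), (I₂,u₂) there are x ∈ I₁, y ∈ I₂ with u₁N(x) + u₂N(y) = 1», local part of the proof: «p odd, p ∣ m (ramified): … one needs a
residue s mod p with s AND 1 − s quadratic NON-residues; their number is … (p − (−1∕p))∕4 ≥ 1 for every odd p (p = 3: s = 2; p = 5: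
s = 3)»; «p = 2: V₂ mod 8 = V₈(m) depends on m mod 8 only (V₈ = {0,1,3,4,5,7} for m ≡ 1, 5; {0,1,4,5,6} for 3; {0,1,2,4,5} for 7;
{0,1,2,4,6,7} for 2; {0,1,2,3,4,6} for 6 (mod 8)), and for EVERY class m mod 8 and EVERY pair of odd residues (ε₁, ε₂) mod 8 the table
gives (x₁,x₂,y₁,y₂) mod 8 with F := ε₁(x₁² − mx₂²) + ε₂(y₁² − my₂²) ≡ 1 (mod 8) AND a variable t with v₂(∂F∕∂t) = 1 (x₁ or y₁ odd, or m odd and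
x₂ or y₂ odd)»; SPLITTING LEMMA: «put w := u₂σ(y)f₁ − u₁σ(x)f₂: ⟨w,v⟩ = 0, ⟨w,w⟩ = u₁u₂(u₁N(x)+u₂N(y)) … det[v w] = −(u₁N(x) + u₂N(y))».
What the kernel holds:

* §1 **`exists_nonresidue_pair`** — `p` an odd prime ⟹ `∃ s : ZMod p, ¬IsSquare s ∧ ¬IsSquare (1 − s)`. PROOF (kernel): with `χ` the
  quadratic character, if no such `s` existed every term of `T = Σ_s (1 − χ(s))(1 − χ(1 − s))` would vanish, so
  `Σ_s χ(s)χ(1 − s) = −p` (using `Σχ = 0` twice); but the `s = 0` term is `0` and every other term is `≥ −1`, so the sum is `≥ −(p − 1)` —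
  contradiction. (The printed exact count `(p − (−1∕p))∕4` is not needed and not formalised.) Instances `pair_instances` (`p = 3, 5, 7, 11, 13`
  with `s = 2, 3, 3, 2, 6`) by `decide`; `hensel_expansion` (the derivative `2ε₁a` behind the odd-prime Hensel lift).
* §2 **the dyadic cells**: `V8_one`, `V8_five`, `V8_three`, `V8_seven`, `V8_two`, `V8_six` (the value set of `x² − m·y²` on `(ZMod 8)²`
  as a `Finset` image, one per class of `m` mod 8) and **`dyadic_witness_m1` … `dyadic_witness_m7`** (for every pair of odd `ε₁, ε₂`
  mod 8 a witness `(x₁,x₂,y₁,y₂)` with `F = 1` in `ZMod 8` and an odd Hensel variable), all by `decide` — the 60∕60 cells of the printed table.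
* §3 **the splitting vector** (conjugates as independent variables `X = σ(x)`, `Y = σ(y)`; `u₁, u₂` rational, i.e. `σ`-fixed):
  `split_orthogonal` (`⟨w,v⟩ = u₁(u₂Y)X + u₂(−u₁X)Y = 0`), `split_norm` (`⟨w,w⟩ = u₁u₂(u₁xX + u₂yY)`), `split_det`
  (`det[[x, u₂Y],[y, −u₁X]] = −(u₁xX + u₂yY)`), `split_unit_consequences` (with `u₁N(x) + u₂N(y) = 1`: `⟨w,w⟩ = u₁u₂`, `det = −1`),
  `sample_cell` (the printed `m ≡ 3`, `(3,7)` cell).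
-/

namespace Summit.Ventures.HSemireg.UnitVectors

open Finset

/-! ## §1 The ramified cell: a pair of consecutive non-residues -/

/-- **Ramified cell of LEMMA UV**: for every odd prime `p` some residue `s` has `s` and `1 − s` both quadratic non-residues mod `p`.
Character-sum proof: otherwise `Σ_s (1 − χ s)(1 − χ(1 − s)) = 0`, i.e. `Σ_s χ(s)χ(1 − s) = −p`, against the trivial bound `≥ −(p − 1)`.
[kernel] -/
theorem exists_nonresidue_pair {p : ℕ} [Fact p.Prime] (hp : p ≠ 2) :
    ∃ s : ZMod p, ¬ IsSquare s ∧ ¬ IsSquare (1 - s) := by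
  classical
  have hchar : ringChar (ZMod p) ≠ 2 := by rw [ZMod.ringChar_zmod_n]; exact hp
  by_contra H
  push Not at H
  set χ := quadraticChar (ZMod p) with hχ
  -- values of χ
  have hval : ∀ a : ZMod p, χ a = 0 ∨ χ a = 1 ∨ χ a = -1 := by
    intro a
    by_cases ha : a = 0
    · left; rw [ha]; exact quadraticChar_zero
    · right; exact quadraticChar_dichotomy ha
  have hone : χ 1 = 1 := by rw [hχ]; exact MulChar.map_one _
  -- every term of T vanishes
  have hterm : ∀ s : ZMod p, (1 - χ s) * (1 - χ (1 - s)) = 0 := by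
    intro s
    by_cases hs : s = 0
    · rw [hs, sub_zero, hone]; ring
    · rcases quadraticChar_dichotomy hs with h1 | h1
      · rw [show χ s = 1 from h1]; ring
      · have hns : ¬ IsSquare s := quadraticChar_neg_one_iff_not_isSquare.mp h1
        have hsq : IsSquare (1 - s) := H s hns
        have hne : (1 - s) ≠ 0 := by
          intro h0
          have : s = 1 := by linear_combination -h0
          rw [this] at hns
          exact hns ⟨1, by ring⟩
        have h2 : χ (1 - s) = 1 := (quadraticChar_one_iff_isSquare hne).mpr hsq
        rw [h2]; ring
  have hsum0 : ∑ s : ZMod p, χ s = 0 := quadraticChar_sum_zero hchar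
  have hsum1 : ∑ s : ZMod p, χ (1 - s) = 0 := by
    have e := Equiv.sum_comp (Equiv.subLeft (1 : ZMod p)) (fun s => χ s)
    simp only [Equiv.subLeft_apply] at e
    rw [e]; exact hsum0
  have hT : ∑ s : ZMod p, (1 - χ s) * (1 - χ (1 - s)) = 0 := Finset.sum_eq_zero (fun s _ => hterm s)
  have hexp : ∑ s : ZMod p, (1 - χ s) * (1 - χ (1 - s))
      = ∑ s : ZMod p, (1 : ℤ) - ∑ s : ZMod p, χ s - ∑ s : ZMod p, χ (1 - s) + ∑ s : ZMod p, χ s * χ (1 - s) := by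
    have e : ∀ s : ZMod p, (1 - χ s) * (1 - χ (1 - s)) = 1 - χ s - χ (1 - s) + χ s * χ (1 - s) := fun s => by ring
    simp only [e, Finset.sum_add_distrib, Finset.sum_sub_distrib]
  have hcard : ∑ _s : ZMod p, (1 : ℤ) = p := by
    simp only [Finset.sum_const, Finset.card_univ, ZMod.card, nsmul_eq_mul, mul_one]
  rw [hexp, hsum0, hsum1, hcard] at hT
  -- so Σ χ(s)χ(1−s) = −p; but the s = 0 term is 0 and the others are ≥ −1
  have hge : ∀ s : ZMod p, -1 ≤ χ s * χ (1 - s) := by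
    intro s
    rcases hval s with h | h | h <;> rcases hval (1 - s) with h' | h' | h' <;> rw [h, h'] <;> norm_num
  have h0 : χ 0 * χ (1 - 0) = 0 := by rw [quadraticChar_zero, zero_mul]
  have hsplit := Finset.add_sum_erase (Finset.univ : Finset (ZMod p)) (fun s => χ s * χ (1 - s)) (Finset.mem_univ 0)
  have hrest : -((Finset.univ.erase (0 : ZMod p)).card : ℤ) ≤ ∑ s ∈ Finset.univ.erase (0 : ZMod p), χ s * χ (1 - s) := by
    have := Finset.sum_le_sum (fun s (_ : s ∈ Finset.univ.erase (0 : ZMod p)) => hge s)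
    simpa using this
  have hcard' : ((Finset.univ.erase (0 : ZMod p)).card : ℤ) = p - 1 := by
    rw [Finset.card_erase_of_mem (Finset.mem_univ _), Finset.card_univ, ZMod.card]
    have : 1 ≤ p := (Fact.out : p.Prime).one_lt.le
    push_cast [Nat.cast_sub this]; ring
  rw [h0, zero_add] at hsplit
  rw [hcard'] at hrest
  rw [← hsplit] at hT
  linarith

/-- Instances of the ramified cell: `p = 3: s = 2`, `p = 5: s = 3` (as printed), `p = 7: s = 3`, `p = 11: s = 2`, `p = 13: s = 6`
(stated as `∀ r, r² ≠ s ∧ r² ≠ 1 − s`). [kernel, `decide`] -/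
theorem pair_instances :
    (∀ r : ZMod 3, r ^ 2 ≠ 2 ∧ r ^ 2 ≠ 1 - 2) ∧ (∀ r : ZMod 5, r ^ 2 ≠ 3 ∧ r ^ 2 ≠ 1 - 3) ∧
    (∀ r : ZMod 7, r ^ 2 ≠ 3 ∧ r ^ 2 ≠ 1 - 3) ∧ (∀ r : ZMod 11, r ^ 2 ≠ 2 ∧ r ^ 2 ≠ 1 - 2) ∧
    (∀ r : ZMod 13, r ^ 2 ≠ 6 ∧ r ^ 2 ≠ 1 - 6) := by
  refine ⟨by decide, by decide, by decide, by decide, by decide⟩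

/-- Hensel's input at an odd ramified prime: from `ε₁a² + ε₂b² = 1` (units) the partial derivative `2ε₁a` is a unit as soon as `2`, `ε₁`,
`a` are — recorded as the ring identity `∂∕∂a (ε₁a² + ε₂b²) = 2ε₁a`, i.e. `ε₁(a + h)² + ε₂b² = (ε₁a² + ε₂b²) + (2ε₁a)h + ε₁h²`. [kernel, `ring`] -/
theorem hensel_expansion {R : Type*} [CommRing R] (ε₁ ε₂ a b h : R) :
    ε₁ * (a + h) ^ 2 + ε₂ * b ^ 2 = (ε₁ * a ^ 2 + ε₂ * b ^ 2) + (2 * ε₁ * a) * h + ε₁ * h ^ 2 := by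
  ring

/-! ## §2 The dyadic cells: `V₈(m)` and the `p = 2` witness table -/

/-- `V₈(m)` for `m ≡ 1 (mod 8)`: the values of `x² − m·y²` mod 8 are `{0,1,3,4,5,7}`. [kernel, `decide`] -/
theorem V8_one : (Finset.univ.image fun q : ZMod 8 × ZMod 8 => q.1 ^ 2 - 1 * q.2 ^ 2) = {0, 1, 3, 4, 5, 7} := by decide

/-- `V₈(m)` for `m ≡ 5 (mod 8)`: `{0,1,3,4,5,7}`. [kernel, `decide`] -/
theorem V8_five : (Finset.univ.image fun q : ZMod 8 × ZMod 8 => q.1 ^ 2 - 5 * q.2 ^ 2) = {0, 1, 3, 4, 5, 7} := by decide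

/-- `V₈(m)` for `m ≡ 3 (mod 8)`: `{0,1,4,5,6}`. [kernel, `decide`] -/
theorem V8_three : (Finset.univ.image fun q : ZMod 8 × ZMod 8 => q.1 ^ 2 - 3 * q.2 ^ 2) = {0, 1, 4, 5, 6} := by decide

/-- `V₈(m)` for `m ≡ 7 (mod 8)`: `{0,1,2,4,5}`. [kernel, `decide`] -/
theorem V8_seven : (Finset.univ.image fun q : ZMod 8 × ZMod 8 => q.1 ^ 2 - 7 * q.2 ^ 2) = {0, 1, 2, 4, 5} := by decide

/-- `V₈(m)` for `m ≡ 2 (mod 8)`: `{0,1,2,4,6,7}`. [kernel, `decide`] -/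
theorem V8_two : (Finset.univ.image fun q : ZMod 8 × ZMod 8 => q.1 ^ 2 - 2 * q.2 ^ 2) = {0, 1, 2, 4, 6, 7} := by decide

/-- `V₈(m)` for `m ≡ 6 (mod 8)`: `{0,1,2,3,4,6}`. [kernel, `decide`] -/
theorem V8_six : (Finset.univ.image fun q : ZMod 8 × ZMod 8 => q.1 ^ 2 - 6 * q.2 ^ 2) = {0, 1, 2, 3, 4, 6} := by decide

/-- **Dyadic witness cells, `m ≡ 1 (mod 8)`**: for all odd `ε₁, ε₂` mod 8 there are `x₁ x₂ y₁ y₂` with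
`ε₁(x₁² − m x₂²) + ε₂(y₁² − m y₂²) = 1` in `ZMod 8` and an odd Hensel variable (`x₁`, `y₁`, `x₂` or `y₂` odd — `m` is odd here).
[kernel, `decide`] -/
theorem dyadic_witness_m1 : ∀ e₁ e₂ : ZMod 8, e₁.val % 2 = 1 → e₂.val % 2 = 1 →
    ∃ x₁ x₂ y₁ y₂ : ZMod 8, e₁ * (x₁ ^ 2 - 1 * x₂ ^ 2) + e₂ * (y₁ ^ 2 - 1 * y₂ ^ 2) = 1 ∧
      (x₁.val % 2 = 1 ∨ y₁.val % 2 = 1 ∨ x₂.val % 2 = 1 ∨ y₂.val % 2 = 1) := by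
  decide

/-- **Dyadic witness cells, `m ≡ 5 (mod 8)`** (Hensel variable among `x₁, y₁, x₂, y₂`; `m` odd). [kernel, `decide`] -/
theorem dyadic_witness_m5 : ∀ e₁ e₂ : ZMod 8, e₁.val % 2 = 1 → e₂.val % 2 = 1 →
    ∃ x₁ x₂ y₁ y₂ : ZMod 8, e₁ * (x₁ ^ 2 - 5 * x₂ ^ 2) + e₂ * (y₁ ^ 2 - 5 * y₂ ^ 2) = 1 ∧
      (x₁.val % 2 = 1 ∨ y₁.val % 2 = 1 ∨ x₂.val % 2 = 1 ∨ y₂.val % 2 = 1) := by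
  decide

/-- **Dyadic witness cells, `m ≡ 3 (mod 8)`** (`m` odd). [kernel, `decide`] -/
theorem dyadic_witness_m3 : ∀ e₁ e₂ : ZMod 8, e₁.val % 2 = 1 → e₂.val % 2 = 1 →
    ∃ x₁ x₂ y₁ y₂ : ZMod 8, e₁ * (x₁ ^ 2 - 3 * x₂ ^ 2) + e₂ * (y₁ ^ 2 - 3 * y₂ ^ 2) = 1 ∧
      (x₁.val % 2 = 1 ∨ y₁.val % 2 = 1 ∨ x₂.val % 2 = 1 ∨ y₂.val % 2 = 1) := by
  decide

/-- **Dyadic witness cells, `m ≡ 7 (mod 8)`** (`m` odd). [kernel, `decide`] -/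
theorem dyadic_witness_m7 : ∀ e₁ e₂ : ZMod 8, e₁.val % 2 = 1 → e₂.val % 2 = 1 →
    ∃ x₁ x₂ y₁ y₂ : ZMod 8, e₁ * (x₁ ^ 2 - 7 * x₂ ^ 2) + e₂ * (y₁ ^ 2 - 7 * y₂ ^ 2) = 1 ∧
      (x₁.val % 2 = 1 ∨ y₁.val % 2 = 1 ∨ x₂.val % 2 = 1 ∨ y₂.val % 2 = 1) := by
  decide

/-- **Dyadic witness cells, `m ≡ 2 (mod 8)`** (`m` even: the Hensel variable must be `x₁` or `y₁`). [kernel, `decide`] -/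
theorem dyadic_witness_m2 : ∀ e₁ e₂ : ZMod 8, e₁.val % 2 = 1 → e₂.val % 2 = 1 →
    ∃ x₁ x₂ y₁ y₂ : ZMod 8, e₁ * (x₁ ^ 2 - 2 * x₂ ^ 2) + e₂ * (y₁ ^ 2 - 2 * y₂ ^ 2) = 1 ∧
      (x₁.val % 2 = 1 ∨ y₁.val % 2 = 1) := by
  decide

/-- **Dyadic witness cells, `m ≡ 6 (mod 8)`** (`m` even: Hensel variable `x₁` or `y₁`). [kernel, `decide`] -/
theorem dyadic_witness_m6 : ∀ e₁ e₂ : ZMod 8, e₁.val % 2 = 1 → e₂.val % 2 = 1 →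
    ∃ x₁ x₂ y₁ y₂ : ZMod 8, e₁ * (x₁ ^ 2 - 6 * x₂ ^ 2) + e₂ * (y₁ ^ 2 - 6 * y₂ ^ 2) = 1 ∧
      (x₁.val % 2 = 1 ∨ y₁.val % 2 = 1) := by
  decide

/-- The printed sample cell «m ≡ 3, (ε₁,ε₂) = (3,7): F(0,1,1,1) = 3·(−3) + 7·(1−3) = −23 ≡ 1 (mod 8)». [kernel, `decide`] -/
theorem sample_cell : (3 : ZMod 8) * (0 ^ 2 - 3 * 1 ^ 2) + 7 * (1 ^ 2 - 3 * 1 ^ 2) = 1 := by decide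

/-! ## §3 The splitting vector -/

/-- **`⟨w, v⟩ = 0`** for `v = x f₁ + y f₂`, `w = u₂σ(y) f₁ − u₁σ(x) f₂` and the form `⟨a f₁ + b f₂, c f₁ + d f₂⟩ = u₁ a σ(c) + u₂ b σ(d)`
(conjugates as independent variables `X = σ(x)`, `Y = σ(y)`; `u₁, u₂` are `σ`-fixed). [kernel, `ring`] -/
theorem split_orthogonal {R : Type*} [CommRing R] (u₁ u₂ X Y : R) :
    u₁ * (u₂ * Y) * X + u₂ * (-(u₁ * X)) * Y = 0 := by
  ring

/-- **`⟨w, w⟩ = u₁u₂·(u₁N(x) + u₂N(y))`** (`σ(w) = u₂ y f₁ − u₁ x f₂` coefficientwise). [kernel, `ring`] -/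
theorem split_norm {R : Type*} [CommRing R] (u₁ u₂ x X y Y : R) :
    u₁ * (u₂ * Y) * (u₂ * y) + u₂ * (-(u₁ * X)) * (-(u₁ * x)) = u₁ * u₂ * (u₁ * (x * X) + u₂ * (y * Y)) := by
  ring

/-- **`det[v w] = −(u₁N(x) + u₂N(y))`** in the frame `f₁, f₂`: `det [[x, u₂Y],[y, −u₁X]] = −(u₁ xX + u₂ yY)`; with
`u₁N(x) + u₂N(y) = 1` the pair `(v, w)` is a basis change of determinant `−1`. [kernel, `ring`] -/
theorem split_det {R : Type*} [CommRing R] (u₁ u₂ x X y Y : R) :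
    x * (-(u₁ * X)) - (u₂ * Y) * y = -(u₁ * (x * X) + u₂ * (y * Y)) := by
  ring

/-- With `u₁N(x) + u₂N(y) = 1`: `⟨w,w⟩ = u₁u₂` and `det[v w] = −1` (the two printed consequences). [kernel] -/
theorem split_unit_consequences {R : Type*} [CommRing R] (u₁ u₂ x X y Y : R) (h : u₁ * (x * X) + u₂ * (y * Y) = 1) :
    u₁ * (u₂ * Y) * (u₂ * y) + u₂ * (-(u₁ * X)) * (-(u₁ * x)) = u₁ * u₂ ∧
      x * (-(u₁ * X)) - (u₂ * Y) * y = -1 := by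
  constructor
  · rw [split_norm, h, mul_one]
  · rw [split_det, h]

end Summit.Ventures.HSemireg.UnitVectors
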